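import Literature.AlgebraicGeometry.Modules.DetClassOfIso
import Literature.AlgebraicGeometry.Modules.PullbackAffineChart
import Literature.AlgebraicGeometry.Modules.FrameRestriction
import HarnessLib

/-!
# Transition functions across an isomorphism of inverse images ("wedge transitions")

Layer `Literature/AlgebraicGeometry/Modules`, namespace `Literature.AlgebraicGeometry.Modules`.
THEOREMS ONLY (no definition, no named fact, no instance).

Bookkeeping for gluing rank-one modules along an open cover from a DESCENT DATUM ON WEDGES
(`Modules/RankOneZariskiGluing.lean`; [StacksProject, Tag 04TP]).  A *wedge* is a scheme `T` with two
morphisms `a : T ⟶ Y₁`, `b : T ⟶ Y₂` and an isomorphism `φ : a^*L₁ ≅ b^*L₂` of inverse images of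
modules `Lₖ` on `Yₖ`.  Given frames `e₁ : 𝒪^{I₁} ≅ L₁|_{U₁}`, `e₂ : 𝒪^{I₂} ≅ L₂|_{U₂}`, the pulled-back
frame `a^*e₁` (the tree's `pullbackFrame`, basis sections `η_a(b_i)`) transported along `φ` and the
pulled-back frame `b^*e₂` are two frames of the SAME module `b^*L₂`, over `a⁻¹U₁` and `b⁻¹U₂`; the
determinant of their transition matrix over an open `O` below both,

  `transitionDet (pullbackFrame a e₁ ≪≫ (φ restricted to a⁻¹U₁)) (pullbackFrame b e₂) ε₁ ε₂ k₁ k₂ ∈ Γ(T, O)`,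

is the *wedge transition function* (in rank one: the unit `u` with `φ(η_a b₁) = u · η_b b₂`).  This file
proves its calculus (all statements are about the tree's `transitionDet`; nothing is defined):

* `pullbackFrame_trans_mapIso` — `t^*(e ≪≫ φ|) = t^*e ≪≫ (t^*φ)|` (naturality of the unit
  `η_t`, ★ `pullback_map_app_unitSection`);
* `pullbackFrame_pullbackFrame_trans_pullbackComp` — `t^*(b^*e) ≪≫ pullbackComp = (t ≫ b)^*e`
  (★ `pullbackComp_hom_app_unitSection`; EGA 0_I (4.4.8), transitivity of inverse images on local bases);
* `transitionDet_wedge_mul` — MULTIPLICATIVITY along a cocycle `φ₁₂ ≪≫ φ₂₃ = φ₁₃` of isomorphisms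
  `a^*L₁ ≅ b^*L₂ ≅ c^*L₃` (★ `transitionDet_trans_mapIso`, ★ `transitionDet_mul`);
* `transitionDet_wedge_refl` — on the DIAGONAL wedge (`φ = 1`) the wedge transition of two frames of
  `L` is the pull-back `a^♯ det T(e, e')` of their transition function (★ `transitionDet_pullbackFrame`);
* `transitionDet_wedge_baseChange` — BASE CHANGE along `t : T' ⟶ T`: if `t^*φ` corresponds to
  `φ' : (t ≫ a)^*L₁ ≅ (t ≫ b)^*L₂` under Mathlib's `Scheme.Modules.pullbackComp`, then `t^♯` of the wedge
  transition of `(a, b, φ)` is the wedge transition of `(t ≫ a, t ≫ b, φ')`;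
* `transitionDet_wedge_congr` — invariance under propositionally equal wedge maps.

Consumer: `Modules/RankOneZariskiGluing.lean` (glueing rank-one modules along an open cover from a descent
datum on wedges, [StacksProject, Tag 04TP]).  Everything is proved; no named facts.

## References

* The Stacks Project, Tag 04TP (glueing sheaves of modules), Tag 00AK (glueing sheaves). [StacksProject]
* A. Grothendieck, J. Dieudonné, *EGA I* (Springer 1971), 0, (4.4.3)–(4.4.8). [folklore]
* R. Hartshorne, *Algebraic Geometry*, GTM 52 (1977), II.5 (p. 110), II Ex. 5.16. [Hartshorne1977]
-/

noncomputable section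

-- `TopCat.Presheaf`/`Scheme.Modules` are not reducible (as in Mathlib's `AlgebraicGeometry/Modules/Sheaf.lean`).
set_option backward.isDefEq.respectTransparency false

open CategoryTheory AlgebraicGeometry Opposite TopologicalSpace

universe u

namespace Literature.AlgebraicGeometry.Modules

open Literature.AlgebraicGeometry.Motives

/-! ### Frames transported along an isomorphism, and pulled back -/

section Frames

variable {T T' : Scheme.{u}} (t : T' ⟶ T) {N N' : T.Modules} {W : T.Opens} {I : Type u} [Fintype I]

omit [Fintype I] in
/-- Basis sections of a frame followed by an isomorphism of restricted modules are the images of the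
basis sections (the tree's private `basisSection_trans` of `Modules/DetClassOfIso`, restated). [folklore] -/
private theorem basisSection_trans_eq_appLE (e : SheafOfModules.free I ≅ N.over W) (ψ : N.over W ≅ N'.over W) (i : I) :
    basisSection (e ≪≫ ψ) i = appLE ψ.hom (𝟙 W) (basisSection e i) := by
  unfold basisSection
  rw [Iso.trans_hom, SheafOfModules.freeHomEquiv_comp_apply, overSectionsEquiv_sectionsMap']

/-- **`t^*(e ≪≫ φ|_W) = t^*e ≪≫ (t^*φ)|_{t⁻¹W}`**: pulling back a frame transported along an isomorphism
of modules `φ : N ≅ N'` gives the pulled-back frame transported along `t^*φ` (both have the basis sections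
`η_t(φ(b_i)) = (t^*φ)(η_t(b_i))`, naturality of the unit of `t^* ⊣ t_*`; Hartshorne II.5: `f^*` of a locally free
sheaf is locally free on the pulled-back local bases). [cite: Hartshorne1977, II.5 (p. 110)] -/
theorem pullbackFrame_trans_mapIso (e : SheafOfModules.free I ≅ N.over W) (φ : N ≅ N') :
    pullbackFrame t (e ≪≫ (SheafOfModules.overFunctor _ W).mapIso φ) =
      pullbackFrame t e ≪≫
        (SheafOfModules.overFunctor _ (t ⁻¹ᵁ W)).mapIso ((Scheme.Modules.pullback t).mapIso φ) := by
  refine frame_ext fun i => ?_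
  rw [basisSection_pullbackFrame, basisSection_trans_eq_appLE, basisSection_trans_eq_appLE,
    basisSection_pullbackFrame, Functor.mapIso_hom, Functor.mapIso_hom, appLE_over_map, appLE_over_map,
    Functor.mapIso_hom, pullback_map_app_unitSection]

end Frames

section Comp

variable {T T' Y : Scheme.{u}} (t : T' ⟶ T) (b : T ⟶ Y) {M : Y.Modules} {U : Y.Opens} {I : Type u}
  [Fintype I]

/-- **`t^*(b^*e) ≪≫ pullbackComp = (t ≫ b)^*e`**: the frame of `t^* b^* M` over `t⁻¹ b⁻¹ U` pulled back
twice, transported along Mathlib's `Scheme.Modules.pullbackComp t b : b^* ⋙ t^* ≅ (t ≫ b)^*`, is the frame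
pulled back along the composite (basis sections `η_t(η_b(b_i)) ↦ η_{t ≫ b}(b_i)`, ★
`pullbackComp_hom_app_unitSection`; transitivity of inverse images on local bases, Hartshorne II.5 p. 110 /
EGA 0_I (4.4.8)). [cite: Hartshorne1977, II.5 (p. 110)] -/
theorem pullbackFrame_pullbackFrame_trans_pullbackComp (e : SheafOfModules.free I ≅ M.over U) :
    pullbackFrame t (pullbackFrame b e) ≪≫
        (SheafOfModules.overFunctor _ (t ⁻¹ᵁ (b ⁻¹ᵁ U))).mapIso ((Scheme.Modules.pullbackComp t b).app M) =
      pullbackFrame (t ≫ b) e := by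
  refine frame_ext fun i => ?_
  rw [basisSection_trans_eq_appLE, basisSection_pullbackFrame, basisSection_pullbackFrame,
    basisSection_pullbackFrame, Functor.mapIso_hom, Iso.app_hom, appLE_over_map]
  exact pullbackComp_hom_app_unitSection b M t U (basisSection e i)

end Comp

/-! ### The calculus of wedge transition functions -/

section Wedge

variable {T Y₁ Y₂ Y₃ : Scheme.{u}} {L₁ : Y₁.Modules} {L₂ : Y₂.Modules} {L₃ : Y₃.Modules}
  (a : T ⟶ Y₁) (b : T ⟶ Y₂) (c : T ⟶ Y₃)
  {U₁ : Y₁.Opens} {U₂ : Y₂.Opens} {U₃ : Y₃.Opens} {I₁ I₂ I₃ : Type u} [Fintype I₁] [Fintype I₂] [Fintype I₃]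
  (e₁ : SheafOfModules.free I₁ ≅ L₁.over U₁) (e₂ : SheafOfModules.free I₂ ≅ L₂.over U₂)
  (e₃ : SheafOfModules.free I₃ ≅ L₃.over U₃) {n₁ n₂ n₃ : ℕ} (ε₁ : I₁ ≃ Fin n₁) (ε₂ : I₂ ≃ Fin n₂)
  (ε₃ : I₃ ≃ Fin n₃) {O : T.Opens}

/-- **Multiplicativity of wedge transition functions along a cocycle of isomorphisms**: for
`φ₁₂ : a^*L₁ ≅ b^*L₂`, `φ₂₃ : b^*L₂ ≅ c^*L₃`, `φ₁₃ : a^*L₁ ≅ c^*L₃` with `φ₁₂ ≪≫ φ₂₃ = φ₁₃`, the wedge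
transition functions multiply: `u(a,b) · u(b,c) = u(a,c)` over any open below `a⁻¹U₁`, `b⁻¹U₂`, `c⁻¹U₃`
(transport the first pair of frames along `φ₂₃`, ★ `transitionDet_trans_mapIso`, then ★ `transitionDet_mul`).
[cite: StacksProject, Tag 04TP (glueing sheaves of modules: the cocycle condition)] -/
theorem transitionDet_wedge_mul
    (φ₁₂ : (Scheme.Modules.pullback a).obj L₁ ≅ (Scheme.Modules.pullback b).obj L₂)
    (φ₂₃ : (Scheme.Modules.pullback b).obj L₂ ≅ (Scheme.Modules.pullback c).obj L₃)
    (φ₁₃ : (Scheme.Modules.pullback a).obj L₁ ≅ (Scheme.Modules.pullback c).obj L₃)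
    (hcoc : φ₁₂ ≪≫ φ₂₃ = φ₁₃) (k₁ : O ⟶ a ⁻¹ᵁ U₁) (k₂ : O ⟶ b ⁻¹ᵁ U₂) (k₃ : O ⟶ c ⁻¹ᵁ U₃) :
    transitionDet (pullbackFrame a e₁ ≪≫ (SheafOfModules.overFunctor _ (a ⁻¹ᵁ U₁)).mapIso φ₁₂)
        (pullbackFrame b e₂) ε₁ ε₂ k₁ k₂ *
      transitionDet (pullbackFrame b e₂ ≪≫ (SheafOfModules.overFunctor _ (b ⁻¹ᵁ U₂)).mapIso φ₂₃)
        (pullbackFrame c e₃) ε₂ ε₃ k₂ k₃ =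
      transitionDet (pullbackFrame a e₁ ≪≫ (SheafOfModules.overFunctor _ (a ⁻¹ᵁ U₁)).mapIso φ₁₃)
        (pullbackFrame c e₃) ε₁ ε₃ k₁ k₃ := by
  rw [← transitionDet_trans_mapIso φ₂₃ (pullbackFrame a e₁ ≪≫
      (SheafOfModules.overFunctor _ (a ⁻¹ᵁ U₁)).mapIso φ₁₂) (pullbackFrame b e₂) ε₁ ε₂ k₁ k₂,
    Iso.trans_assoc, ← Functor.mapIso_trans, hcoc, transitionDet_mul]

/-- **The diagonal wedge**: if the isomorphism `φ : a^*L ≅ a^*L` is the identity, the wedge transition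
function of two frames `e`, `e'` of `L` is the pull-back `a^♯ det T(e, e')` of their transition function
(★ `transitionDet_pullbackFrame`). [cite: Hartshorne1977, II.5 (p. 110)] -/
theorem transitionDet_wedge_refl {U₁' : Y₁.Opens} {I₁' : Type u} [Fintype I₁'] {n₁' : ℕ}
    (e₁' : SheafOfModules.free I₁' ≅ L₁.over U₁') (ε₁' : I₁' ≃ Fin n₁')
    (φ : (Scheme.Modules.pullback a).obj L₁ ≅ (Scheme.Modules.pullback a).obj L₁) (hφ : φ = Iso.refl _)
    (l : O ≤ a ⁻¹ᵁ (U₁ ⊓ U₁')) (k : O ⟶ a ⁻¹ᵁ U₁) (k' : O ⟶ a ⁻¹ᵁ U₁') :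
    transitionDet (pullbackFrame a e₁ ≪≫ (SheafOfModules.overFunctor _ (a ⁻¹ᵁ U₁)).mapIso φ)
        (pullbackFrame a e₁') ε₁ ε₁' k k' =
      a.appLE (U₁ ⊓ U₁') O l (transitionDet e₁ e₁' ε₁ ε₁' (homOfLE inf_le_left) (homOfLE inf_le_right)) := by
  subst hφ
  rw [Functor.mapIso_refl, Iso.trans_refl]
  exact transitionDet_pullbackFrame a e₁ e₁' ε₁ ε₁' l k k'

/-- **Base change of wedge transition functions** along `t : T' ⟶ T`: if `t^*φ` is `φ' : (t ≫ a)^*L₁ ≅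
(t ≫ b)^*L₂` up to Mathlib's `Scheme.Modules.pullbackComp` isomorphisms, then `t^♯` of the wedge transition
function of `(a, b, φ)` over `O` is the wedge transition function of `(t ≫ a, t ≫ b, φ')` over any `O' ≤ t⁻¹O`
(★ `transitionDet_pullbackFrame` for `t`, then the two frame identities of this file and ★
`transitionDet_trans_mapIso`). [cite: StacksProject, Tag 04TP (glueing sheaves of modules)] -/
theorem transitionDet_wedge_baseChange {T' : Scheme.{u}} (t : T' ⟶ T)
    (φ : (Scheme.Modules.pullback a).obj L₁ ≅ (Scheme.Modules.pullback b).obj L₂)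
    (φ' : (Scheme.Modules.pullback (t ≫ a)).obj L₁ ≅ (Scheme.Modules.pullback (t ≫ b)).obj L₂)
    (hφ' : (Scheme.Modules.pullback t).mapIso φ =
      (Scheme.Modules.pullbackComp t a).app L₁ ≪≫ φ' ≪≫ ((Scheme.Modules.pullbackComp t b).app L₂).symm)
    (k₁ : O ⟶ a ⁻¹ᵁ U₁) (k₂ : O ⟶ b ⁻¹ᵁ U₂) {O' : T'.Opens} (l : O' ≤ t ⁻¹ᵁ O)
    (k₁' : O' ⟶ (t ≫ a) ⁻¹ᵁ U₁) (k₂' : O' ⟶ (t ≫ b) ⁻¹ᵁ U₂) :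
    t.appLE O O' l
        (transitionDet (pullbackFrame a e₁ ≪≫ (SheafOfModules.overFunctor _ (a ⁻¹ᵁ U₁)).mapIso φ)
          (pullbackFrame b e₂) ε₁ ε₂ k₁ k₂) =
      transitionDet (pullbackFrame (t ≫ a) e₁ ≪≫ (SheafOfModules.overFunctor _ ((t ≫ a) ⁻¹ᵁ U₁)).mapIso φ')
        (pullbackFrame (t ≫ b) e₂) ε₁ ε₂ k₁' k₂' := by
  -- move the transition function of `(a, b, φ)` to `a⁻¹U₁ ⊓ b⁻¹U₂` and pull it back along `t`
  have l' : O' ≤ t ⁻¹ᵁ (a ⁻¹ᵁ U₁ ⊓ b ⁻¹ᵁ U₂) := fun z hz => ⟨k₁.le (l hz), k₂.le (l hz)⟩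
  have step₁ : t.appLE O O' l
      (transitionDet (pullbackFrame a e₁ ≪≫ (SheafOfModules.overFunctor _ (a ⁻¹ᵁ U₁)).mapIso φ)
        (pullbackFrame b e₂) ε₁ ε₂ k₁ k₂) =
      t.appLE (a ⁻¹ᵁ U₁ ⊓ b ⁻¹ᵁ U₂) O' l'
        (transitionDet (pullbackFrame a e₁ ≪≫ (SheafOfModules.overFunctor _ (a ⁻¹ᵁ U₁)).mapIso φ)
          (pullbackFrame b e₂) ε₁ ε₂ (homOfLE inf_le_left) (homOfLE inf_le_right)) := by
    rw [transitionDet_congr_hom _ _ ε₁ ε₂ k₁ (homOfLE (le_inf k₁.le k₂.le) ≫ homOfLE inf_le_left) k₂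
        (homOfLE (le_inf k₁.le k₂.le) ≫ homOfLE inf_le_right),
      ← transitionDet_map]
    change (T.presheaf.map (homOfLE _).op ≫ t.appLE O O' l) _ = _
    rw [Scheme.Hom.map_appLE]
  rw [step₁, ← transitionDet_pullbackFrame t _ _ ε₁ ε₂ l' (k₁' ≫ eqToHom rfl) (k₂' ≫ eqToHom rfl),
    pullbackFrame_trans_mapIso, hφ']
  -- rewrite the doubly pulled-back frames through `pullbackComp`
  have eb : pullbackFrame t (pullbackFrame b e₂) = pullbackFrame (t ≫ b) e₂ ≪≫
      (SheafOfModules.overFunctor _ (t ⁻¹ᵁ (b ⁻¹ᵁ U₂))).mapIso ((Scheme.Modules.pullbackComp t b).app L₂).symm := by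
    rw [← pullbackFrame_pullbackFrame_trans_pullbackComp t b e₂, Iso.trans_assoc, ← Functor.mapIso_trans,
      Iso.self_symm_id, Functor.mapIso_refl, Iso.trans_refl]
  have ea : pullbackFrame t (pullbackFrame a e₁) ≪≫
      (SheafOfModules.overFunctor _ (t ⁻¹ᵁ (a ⁻¹ᵁ U₁))).mapIso
        ((Scheme.Modules.pullbackComp t a).app L₁ ≪≫ φ' ≪≫ ((Scheme.Modules.pullbackComp t b).app L₂).symm) =
      (pullbackFrame (t ≫ a) e₁ ≪≫ (SheafOfModules.overFunctor _ ((t ≫ a) ⁻¹ᵁ U₁)).mapIso φ') ≪≫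
        (SheafOfModules.overFunctor _ (t ⁻¹ᵁ (a ⁻¹ᵁ U₁))).mapIso
          ((Scheme.Modules.pullbackComp t b).app L₂).symm := by
    rw [Functor.mapIso_trans, Functor.mapIso_trans, ← Iso.trans_assoc,
      pullbackFrame_pullbackFrame_trans_pullbackComp t a e₁, Iso.trans_assoc]
    rfl
  rw [eb, ea, transitionDet_trans_mapIso]
  exact transitionDet_congr_hom _ _ ε₁ ε₂ _ _ _ _

/-- Wedge transition functions along propositionally equal wedge maps agree (`φ` a family of
isomorphisms indexed by the wedge maps and a compatibility proof; bookkeeping for descent data on wedges).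
[cite: StacksProject, Tag 04TP (glueing sheaves of modules)] -/
theorem transitionDet_wedge_congr {S : Scheme.{u}} (f₁ : Y₁ ⟶ S) (f₂ : Y₂ ⟶ S)
    (φ : ∀ (a : T ⟶ Y₁) (b : T ⟶ Y₂), a ≫ f₁ = b ≫ f₂ →
      ((Scheme.Modules.pullback a).obj L₁ ≅ (Scheme.Modules.pullback b).obj L₂))
    {a a' : T ⟶ Y₁} {b b' : T ⟶ Y₂} (ha : a = a') (hb : b = b') (h : a ≫ f₁ = b ≫ f₂)
    (h' : a' ≫ f₁ = b' ≫ f₂) (k₁ : O ⟶ a ⁻¹ᵁ U₁) (k₂ : O ⟶ b ⁻¹ᵁ U₂) (k₁' : O ⟶ a' ⁻¹ᵁ U₁)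
    (k₂' : O ⟶ b' ⁻¹ᵁ U₂) :
    transitionDet (pullbackFrame a e₁ ≪≫ (SheafOfModules.overFunctor _ (a ⁻¹ᵁ U₁)).mapIso (φ a b h))
        (pullbackFrame b e₂) ε₁ ε₂ k₁ k₂ =
      transitionDet (pullbackFrame a' e₁ ≪≫ (SheafOfModules.overFunctor _ (a' ⁻¹ᵁ U₁)).mapIso (φ a' b' h'))
        (pullbackFrame b' e₂) ε₁ ε₂ k₁' k₂' := by
  subst ha hb
  exact transitionDet_congr_hom _ _ ε₁ ε₂ _ _ _ _

end Wedge

end Literature.AlgebraicGeometry.Modules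

end
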